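import Summits.AnomalousDissipation.AnomalousDissipation.Theorems.PointSinkPointFluxConeBoxIterationTools
import HarnessLib

/-!
# Stub `stub_boxIteration` — the explicit convex-integration iteration in the box, with pressure
(crux `PointSink.PointFluxCone`, stmt-AnomalousDissipation-19033, line `Sketch`)

The box version of the tree's `Literature/Analysis/FluidPDE/StationaryEulerIteration.lean`
(Choffrut–Székelyhidi 2014, §2 Step 3, run as an explicit iteration instead of Baire category).
Given the perturbation step STEP in the unit box of `ℝ³` (hypothesis; it is the neighbouring stub
`stub_boxStep`), a smooth strict subsolution `w₀` supported in the open box with `w₀(x) ∈ 𝒰_{e(x)}`,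
`div v₀ = 0`, `div u₀ = 0` classically, finitely many continuous test fields and budgets `θ, δ > 0`,
we build states `w_{k+1} = w_k + W_k` and pressures `π_{k+1} = π_k + q_k`, where `W_k` is the field
and `q_k = prC` the pressure of the grid packet of STEP applied to `w_k` with the test fields AND
the previous states `w_0, …, w_k` as test fields, tolerance `θ 2^{-(k+1)}` and pressure tolerance
`δ 2^{-(k+1)}`.  Then: the states are smooth, unchanged off the box, in `𝒰_e`; `div v_k = 0` and
`div (u_k + π_k I) = 0` classically (`Packet.div_velC`, `Packet.div_strSC`, `u_P = S - q I`); the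
Gram matrix `∫⟪w_m, w_n⟫` satisfies the hypotheses of the abstract bookkeeping lemma `boxIter_gram`
(near-orthogonality, uniform bound `‖w_k‖ ≤ √ē + 9ē`), whence the `L²` Cauchy property and the
decay of the defects `∫_{box} (e - |v_k|²) → 0`; and `|∫⟪w_k - w₀, p_a⟫| ≤ Σ_{j<k} θ 2^{-(j+1)} ≤ θ`.

References: A. Choffrut, L. Székelyhidi Jr., SIAM J. Math. Anal. 46 (2014), §2 Step 3;
L. Székelyhidi Jr., *From isometric embeddings to turbulence* (2012), §5–6.
-/

noncomputable section

open scoped InnerProductSpace ContDiff ENNReal Topology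
open Set Function MeasureTheory Metric Filter
open Literature.Analysis.FluidPDE Literature.Analysis.FluidPDE.StationaryEuler
open Literature.Analysis.FunctionSpaces

set_option linter.dupNamespace false

namespace Summit.AnomalousDissipation.AnomalousDissipation.Theorems

/-- **STEP → ITER (the explicit iteration, with pressure).** From a smooth strict subsolution
`w₀` supported in the open unit box with vanishing pressure (`div v₀ = 0`, `div u₀ = 0` classically)
and `w₀(x) ∈ 𝒰_{e(x)}` everywhere (`e` continuous, `e ≤ ē`), finitely many continuous test fields,
and budgets `θ, δ > 0`: states `w_k = w₀ + Σ_{j<k} W_j` (grid packets of STEP with tolerance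
`θ/2^{j+1}`, pressure tolerance `δ/2^{j+1}`, near-orthogonal to the test fields AND to
`w_0,…,w_j`) and pressures `π_k = Σ_{j<k} prC_j` such that: smooth; unchanged off the box; in `𝒰_e`;
pressure increments `≤ δ/2^{k+1}`; classical `div v_k = 0` and `div (u_k + π_k I) = 0`;
`L²`-Cauchy (monotone bounded corrected energies); defects `∫_{box}(e − |v_k|²) → 0`; accumulated
near-orthogonality `|∫⟪w_k − w₀, p_a⟫| ≤ θ`. [cite: ChoffrutSzekelyhidi2014, §2 Step 3] -/
theorem stub_boxIteration :
    (∀ (e : Ed (Fin 3) → ℝ) (w : Ed (Fin 3) → State (Fin 3)) (N : ℕ)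
      (p : Fin N → Ed (Fin 3) → State (Fin 3)) (ε δ : ℝ),
      Continuous e → Continuous w → (∀ x, w x ∈ HighDim.U (e x)) → (∀ a, Continuous (p a)) →
      0 < ε → 0 < δ →
      ∃ (m : ℕ) (hm : 0 < m) (Q : (Fin 3 → ℤ) → Packet (Fin 3)),
        (∀ κ, Packet.SuppIn (box (Fin 3)) (Q κ)) ∧
        (∀ x, w x + Packet.field (gridPacket hm Q) x ∈ HighDim.U (e x)) ∧
        (∀ a, |∫ x, ⟪Packet.field (gridPacket hm Q) x, p a x⟫_ℝ| ≤ ε) ∧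
        (∀ x, |Packet.prC (gridPacket hm Q) x| ≤ δ) ∧
        (∫ x in box (Fin 3), (e x - ‖vel (w x)‖ ^ 2)) - ε ≤
          ∫ x, ‖Packet.field (gridPacket hm Q) x‖ ^ 2) →
    (∀ (e : Ed (Fin 3) → ℝ) (ebar : ℝ) (w₀ : Ed (Fin 3) → State (Fin 3)) (N : ℕ)
      (p : Fin N → Ed (Fin 3) → State (Fin 3)) (θ δ : ℝ),
      Continuous e → (∀ x, e x ≤ ebar) → ContDiff ℝ ∞ w₀ → (∀ x, x ∉ box (Fin 3) → w₀ x = 0) →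
      (∀ x, w₀ x ∈ HighDim.U (e x)) →
      (∀ x, ∑ i, pd (eb i) (fun y => vel (w₀ y) i) x = 0) →
      (∀ x i, ∑ j, pd (eb j) (fun y => str (w₀ y) i j) x = 0) →
      (∀ a, Continuous (p a)) → 0 < θ → 0 < δ →
      ∃ (w : ℕ → Ed (Fin 3) → State (Fin 3)) (π : ℕ → Ed (Fin 3) → ℝ),
        w 0 = w₀ ∧ (π 0 = fun _ => 0) ∧
        (∀ k, ContDiff ℝ ∞ (w k)) ∧ (∀ k, ContDiff ℝ ∞ (π k)) ∧
        (∀ k x, x ∉ box (Fin 3) → w k x = w₀ x ∧ π k x = 0) ∧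
        (∀ k x, w k x ∈ HighDim.U (e x)) ∧
        (∀ k x, |π (k + 1) x - π k x| ≤ δ / 2 ^ (k + 1)) ∧
        (∀ k x, ∑ i, pd (eb i) (fun y => vel (w k y) i) x = 0) ∧
        (∀ k x i, ∑ j, pd (eb j) (fun y => str (w k y) i j + (if i = j then π k y else 0)) x = 0) ∧
        (∀ η : ℝ, 0 < η → ∃ M : ℕ, ∀ n n', M ≤ n → n ≤ n' → ∫ x, ‖w n' x - w n x‖ ^ 2 < η) ∧
        Tendsto (fun k => ∫ x in box (Fin 3), (e x - ‖vel (w k x)‖ ^ 2)) atTop (𝓝 0) ∧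
        (∀ a k, |∫ x, ⟪w k x - w₀ x, p a x⟫_ℝ| ≤ θ)) := by
  -- adapted from Literature/Analysis/FluidPDE/StationaryEulerIteration.lean (`IterData`)
  intro hS e ebar w₀ N p θ δ he hebar hw₀ hw₀0 hw₀U hdiv₀ hdivs₀ hp hθ hδ
  /- Step 0: the perturbation step, read as one packet supported in the box. -/
  have hS' : ∀ (w : Ed (Fin 3) → State (Fin 3)) (N' : ℕ) (p' : Fin N' → Ed (Fin 3) → State (Fin 3))
      (ε' δ' : ℝ), Continuous w → (∀ x, w x ∈ HighDim.U (e x)) → (∀ a, Continuous (p' a)) →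
      0 < ε' → 0 < δ' →
      ∃ G : Packet (Fin 3), Packet.SuppIn (box (Fin 3)) G ∧
        (∀ x, w x + Packet.field G x ∈ HighDim.U (e x)) ∧
        (∀ a, |∫ x, ⟪Packet.field G x, p' a x⟫_ℝ| ≤ ε') ∧
        (∀ x, |Packet.prC G x| ≤ δ') ∧
        (∫ x in box (Fin 3), (e x - ‖vel (w x)‖ ^ 2)) - ε' ≤ ∫ x, ‖Packet.field G x‖ ^ 2 := by
    intro w N' p' ε' δ' hw hU hp' hε' hδ'
    obtain ⟨m, hm, Q, hQ, h1, h2, h3, h4⟩ := hS e w N' p' ε' δ' he hw hU hp' hε' hδ'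
    exact ⟨gridPacket hm Q, suppIn_gridPacket hm hQ, h1, h2, h3, h4⟩
  choose! G hGs hGU hGo hGp hGg using hS'
  /- Step 1: the iteration, as a sequence of histories `hist k j = w_j` (`j ≤ k`). -/
  obtain ⟨hist, hhist0, hhistS⟩ : ∃ hist : ℕ → ℕ → Ed (Fin 3) → State (Fin 3),
      hist 0 = (fun _ => w₀) ∧ ∀ k, hist (k + 1) = fun j => if j ≤ k then hist k j else
        fun x => hist k k x + Packet.field (G (hist k k) (N + (k + 1))
          (Fin.append p (fun i : Fin (k + 1) => hist k i)) (θ / 2 ^ (k + 1)) (δ / 2 ^ (k + 1))) x :=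
    ⟨fun k => Nat.rec (motive := fun _ => ℕ → Ed (Fin 3) → State (Fin 3)) (fun _ => w₀)
      (fun k hk j => if j ≤ k then hk j else fun x => hk k x + Packet.field (G (hk k) (N + (k + 1))
        (Fin.append p (fun i : Fin (k + 1) => hk i)) (θ / 2 ^ (k + 1)) (δ / 2 ^ (k + 1))) x) k,
      rfl, fun _ => rfl⟩
  obtain ⟨w, hw⟩ : ∃ w : ℕ → Ed (Fin 3) → State (Fin 3), ∀ k, w k = hist k k := ⟨_, fun _ => rfl⟩
  obtain ⟨Gk, hGk⟩ : ∃ Gk : ℕ → Packet (Fin 3), ∀ k, Gk k = G (w k) (N + (k + 1))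
      (Fin.append p (fun i : Fin (k + 1) => hist k i)) (θ / 2 ^ (k + 1)) (δ / 2 ^ (k + 1)) :=
    ⟨_, fun _ => rfl⟩
  obtain ⟨π, hπ⟩ : ∃ π : ℕ → Ed (Fin 3) → ℝ, ∀ k x, π k x = ∑ j ∈ Finset.range k, Packet.prC (Gk j) x :=
    ⟨fun k x => ∑ j ∈ Finset.range k, Packet.prC (Gk j) x, fun _ _ => rfl⟩
  have hw0 : w 0 = w₀ := by rw [hw, hhist0]
  have hwsucc : ∀ k x, w (k + 1) x = w k x + Packet.field (Gk k) x := by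
    intro k x
    have hk : ¬ (k + 1 ≤ k) := Nat.not_succ_le_self k
    rw [hGk, hw (k + 1), hw k, hhistS k]
    simp only [if_neg hk]
  have hhist : ∀ k j, j ≤ k → hist k j = w j := by
    intro k
    induction k with
    | zero => intro j hj; rw [Nat.le_zero.1 hj, hw]
    | succ k ih =>
      intro j hj
      rcases Nat.of_le_succ hj with h | h
      · rw [hhistS k]; simp only [if_pos h]; exact ih j h
      · rw [h, hw]
  have hπsucc : ∀ k x, π (k + 1) x = π k x + Packet.prC (Gk k) x := fun k x => by
    rw [hπ, hπ, Finset.sum_range_succ]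
  /- Step 2: the specification of the `k`-th packet, given the invariants of the history. -/
  have hstep : ∀ k, (∀ j, j ≤ k → ContDiff ℝ ∞ (w j) ∧ (∀ x, x ∉ box (Fin 3) → w j x = 0) ∧
        ∀ x, w j x ∈ HighDim.U (e x)) →
      Packet.SuppIn (box (Fin 3)) (Gk k) ∧ (∀ x, w k x + Packet.field (Gk k) x ∈ HighDim.U (e x)) ∧
      (∀ a, |∫ x, ⟪Packet.field (Gk k) x, p a x⟫_ℝ| ≤ θ / 2 ^ (k + 1)) ∧
      (∀ j, j ≤ k → |∫ x, ⟪Packet.field (Gk k) x, w j x⟫_ℝ| ≤ θ / 2 ^ (k + 1)) ∧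
      (∀ x, |Packet.prC (Gk k) x| ≤ δ / 2 ^ (k + 1)) ∧
      (∫ x in box (Fin 3), (e x - ‖vel (w k x)‖ ^ 2)) - θ / 2 ^ (k + 1) ≤
        ∫ x, ‖Packet.field (Gk k) x‖ ^ 2 := by
    intro k hI
    have hc : Continuous (w k) := (hI k le_rfl).1.continuous
    have hU : ∀ x, w k x ∈ HighDim.U (e x) := (hI k le_rfl).2.2
    have hpc : ∀ a, Continuous (Fin.append p (fun i : Fin (k + 1) => hist k i) a) := by
      intro a
      refine Fin.addCases (fun i => ?_) (fun i => ?_) a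
      · rw [Fin.append_left]; exact hp i
      · rw [Fin.append_right, hhist k i (Nat.le_of_lt_succ i.isLt)]
        exact (hI i (Nat.le_of_lt_succ i.isLt)).1.continuous
    have hε : (0 : ℝ) < θ / 2 ^ (k + 1) := by positivity
    have hδ' : (0 : ℝ) < δ / 2 ^ (k + 1) := by positivity
    refine ⟨?_, ?_, fun a => ?_, fun j hj => ?_, ?_, ?_⟩
    · rw [hGk]; exact hGs _ _ _ _ _ hc hU hpc hε hδ'
    · rw [hGk]; exact hGU _ _ _ _ _ hc hU hpc hε hδ'
    · have h := hGo _ _ _ _ _ hc hU hpc hε hδ' (Fin.castAdd (k + 1) a)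
      rw [Fin.append_left] at h
      rw [hGk]; exact h
    · have h := hGo _ _ _ _ _ hc hU hpc hε hδ' (Fin.natAdd N ⟨j, Nat.lt_succ_of_le hj⟩)
      rw [Fin.append_right, hhist k j hj] at h
      rw [hGk]; exact h
    · rw [hGk]; exact hGp _ _ _ _ _ hc hU hpc hε hδ'
    · rw [hGk]; exact hGg _ _ _ _ _ hc hU hpc hε hδ'
  /- Step 3: the invariants (smooth, zero off the box, in `𝒰_e`), by induction. -/
  have hinv : ∀ k j, j ≤ k → ContDiff ℝ ∞ (w j) ∧ (∀ x, x ∉ box (Fin 3) → w j x = 0) ∧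
      ∀ x, w j x ∈ HighDim.U (e x) := by
    intro k
    induction k with
    | zero =>
      intro j hj
      rw [Nat.le_zero.1 hj, hw0]
      exact ⟨hw₀, hw₀0, hw₀U⟩
    | succ k ih =>
      intro j hj
      rcases Nat.of_le_succ hj with h | h
      · exact ih j h
      · subst h
        obtain ⟨hs, hU', -, -, -, -⟩ := hstep k ih
        have hk := ih k le_rfl
        have hfun : w (k + 1) = fun x => w k x + Packet.field (Gk k) x := funext (hwsucc k)
        refine ⟨?_, fun x hx => ?_, fun x => ?_⟩
        · rw [hfun]; exact hk.1.add (Packet.contDiff_field _)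
        · rw [hwsucc, hk.2.1 x hx, Packet.field_eq_zero_of_suppIn hs hx, add_zero]
        · rw [hwsucc]; exact hU' x
  have hsm : ∀ k, ContDiff ℝ ∞ (w k) := fun k => (hinv k k le_rfl).1
  have hzero : ∀ k x, x ∉ box (Fin 3) → w k x = 0 := fun k => (hinv k k le_rfl).2.1
  have hUk : ∀ k x, w k x ∈ HighDim.U (e x) := fun k => (hinv k k le_rfl).2.2
  have hcont : ∀ k, Continuous (w k) := fun k => (hsm k).continuous
  have hsupp : ∀ k, Packet.SuppIn (box (Fin 3)) (Gk k) := fun k => (hstep k (hinv k)).1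
  have horthp : ∀ k a, |∫ x, ⟪Packet.field (Gk k) x, p a x⟫_ℝ| ≤ θ / 2 ^ (k + 1) :=
    fun k => (hstep k (hinv k)).2.2.1
  have horthw : ∀ k j, j ≤ k → |∫ x, ⟪Packet.field (Gk k) x, w j x⟫_ℝ| ≤ θ / 2 ^ (k + 1) :=
    fun k => (hstep k (hinv k)).2.2.2.1
  have hprC : ∀ k x, |Packet.prC (Gk k) x| ≤ δ / 2 ^ (k + 1) := fun k => (hstep k (hinv k)).2.2.2.2.1
  have hgain : ∀ k, (∫ x in box (Fin 3), (e x - ‖vel (w k x)‖ ^ 2)) - θ / 2 ^ (k + 1) ≤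
      ∫ x, ‖Packet.field (Gk k) x‖ ^ 2 := fun k => (hstep k (hinv k)).2.2.2.2.2
  have hG0 : ∀ k x, x ∉ box (Fin 3) → Packet.field (Gk k) x = 0 := fun k x hx =>
    Packet.field_eq_zero_of_suppIn (hsupp k) hx
  /- Step 4: the pressures. -/
  have hπsm : ∀ k, ContDiff ℝ ∞ (π k) := fun k => by
    have hfun : π k = fun x => ∑ j ∈ Finset.range k, Packet.prC (Gk j) x := funext (hπ k)
    rw [hfun]; exact ContDiff.sum fun j _ => Packet.contDiff_prC _
  /- Step 5: the classical conservation laws. -/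
  have hdivv : ∀ k x, ∑ i, pd (eb i) (fun y => vel (w k y) i) x = 0 := by
    intro k
    induction k with
    | zero => intro x; rw [hw0]; exact hdiv₀ x
    | succ k ih =>
      intro x
      have hfun : w (k + 1) = fun y => w k y + Packet.field (Gk k) y := funext (hwsucc k)
      rw [hfun]
      exact boxIter_div_vel_step (hsm k) (Gk k) (ih x)
  have hdivs : ∀ k x i, ∑ j, pd (eb j) (fun y => str (w k y) i j + (if i = j then π k y else 0)) x = 0 := by
    intro k
    induction k with
    | zero =>
      intro x i
      calc ∑ j, pd (eb j) (fun y => str (w 0 y) i j + (if i = j then π 0 y else 0)) x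
          = ∑ j, pd (eb j) (fun y => str (w₀ y) i j) x := Finset.sum_congr rfl fun j _ =>
            congrArg (fun F : Ed (Fin 3) → ℝ => pd (eb j) F x) (funext fun y => by
              rw [hw0, hπ, Finset.sum_range_zero, ite_self, add_zero])
        _ = 0 := hdivs₀ x i
    | succ k ih =>
      intro x i
      have hfun : w (k + 1) = fun y => w k y + Packet.field (Gk k) y := funext (hwsucc k)
      have hπfun : π (k + 1) = fun y => π k y + Packet.prC (Gk k) y := funext (hπsucc k)
      rw [hfun, hπfun]
      exact boxIter_div_str_step (hsm k) (hπsm k) (Gk k) (ih x i)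
  /- Step 6: energies — the Gram matrix of the states. -/
  obtain ⟨B, hB⟩ : ∃ B : ℕ → ℕ → ℝ, ∀ m n, B m n = ∫ x, ⟪w m x, w n x⟫_ℝ := ⟨_, fun _ _ => rfl⟩
  have hBsymm : ∀ m n, B m n = B n m := fun m n => by
    rw [hB, hB]; simp only [real_inner_comm]
  have hexp : ∀ m n, ∫ x, ‖w m x - w n x‖ ^ 2 = B m m - 2 * B m n + B n n := fun m n => by
    rw [hB, hB, hB]; exact boxIter_integral_norm_sub_sq (hcont m) (hcont n) (hzero m) (hzero n)
  have hpsd : ∀ m n, 0 ≤ B m m - 2 * B m n + B n n := fun m n => by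
    rw [← hexp]; exact integral_nonneg fun x => by positivity
  have hBsucc : ∀ k j, B (k + 1) j = B k j + ∫ x, ⟪Packet.field (Gk k) x, w j x⟫_ℝ := fun k j => by
    have hfun : w (k + 1) = fun y => w k y + Packet.field (Gk k) y := funext (hwsucc k)
    rw [hB, hB, hfun]
    exact boxIter_integral_inner_add (hcont k) (Packet.continuous_field _) (hcont j) (hzero k) (hG0 k)
  have horthB : ∀ j k, j ≤ k → |B (k + 1) j - B k j| ≤ θ / 2 ^ (k + 1) := fun j k hjk => by
    rw [hBsucc, add_sub_cancel_left]; exact horthw k j hjk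
  have hR : ∀ k, B k k ≤ (Real.sqrt ebar + 3 * ebar * 3) ^ 2 := fun k => by
    rw [hB]
    exact boxIter_integral_inner_self_le (hcont k) (hzero k) fun x => boxIter_norm_le_of_mem_U (hebar x) (hUk k x)
  have hεsum : ∀ n, ∑ k ∈ Finset.range n, θ / 2 ^ (k + 1) ≤ θ := boxIter_sum_half_pow_le hθ.le
  obtain ⟨hcauchy, hdefect⟩ :=
    boxIter_gram B (fun k => θ / 2 ^ (k + 1)) θ _ hpsd hεsum horthB hBsymm hR
  /- Step 7: the defects tend to zero. -/
  have hJ : Tendsto (fun k => ∫ x in box (Fin 3), (e x - ‖vel (w k x)‖ ^ 2)) atTop (𝓝 0) := by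
    refine hdefect _ (fun k => setIntegral_nonneg isOpen_box.measurableSet fun x _ =>
      sub_nonneg.2 (norm_vel_sq_le_of_mem_C (HighDim.U_subset_C _ (hUk k x)))) fun k => ?_
    have hfun : (fun x => ‖w (k + 1) x - w k x‖ ^ 2) = fun x => ‖Packet.field (Gk k) x‖ ^ 2 := by
      funext x; rw [hwsucc, add_sub_cancel_left]
    rw [← hexp, hfun]
    exact hgain k
  /- Step 8: the `L²` Cauchy property. -/
  have hC : ∀ η : ℝ, 0 < η → ∃ M : ℕ, ∀ n n', M ≤ n → n ≤ n' → ∫ x, ‖w n' x - w n x‖ ^ 2 < η := by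
    intro η hη
    obtain ⟨M, hM⟩ := hcauchy η hη
    exact ⟨M, fun n n' hn hnn' => by rw [hexp]; exact hM n n' hn hnn'⟩
  /- Step 9: accumulated near-orthogonality to the test fields. -/
  have hT : ∀ a k, |∫ x, ⟪w k x - w₀ x, p a x⟫_ℝ| ≤ ∑ j ∈ Finset.range k, θ / 2 ^ (j + 1) := by
    intro a k
    induction k with
    | zero => simp [hw0]
    | succ k ih =>
      have hfun : (fun x => ⟪w (k + 1) x - w₀ x, p a x⟫_ℝ) =
          fun x => ⟪(w k x - w₀ x) + Packet.field (Gk k) x, p a x⟫_ℝ := by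
        funext x; rw [hwsucc, add_sub_right_comm]
      have hck : Continuous fun x => w k x - w₀ x := (hcont k).sub hw₀.continuous
      rw [hfun, boxIter_integral_inner_add hck (Packet.continuous_field _) (hp a)
        (fun x hx => by show w k x - w₀ x = 0; rw [hzero k x hx, hw₀0 x hx, sub_zero]) (hG0 k),
        Finset.sum_range_succ]
      exact (abs_add_le _ _).trans (add_le_add ih (horthp k a))
  /- Assembly. -/
  refine ⟨w, π, hw0, ?_, hsm, hπsm, fun k x hx => ⟨?_, ?_⟩, hUk, fun k x => ?_, hdivv, hdivs, hC, hJ,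
    fun a k => (hT a k).trans (hεsum k)⟩
  · funext x; rw [hπ, Finset.sum_range_zero]
  · rw [hzero k x hx, hw₀0 x hx]
  · rw [hπ]; exact Finset.sum_eq_zero fun j _ => Packet.prC_eq_zero (hsupp j) hx
  · rw [hπsucc, add_sub_cancel_left]; exact hprC k x

end Summit.AnomalousDissipation.AnomalousDissipation.Theorems
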